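import Literature.Analysis.FluidPDE.PineauVicolWeightExistence
import HarnessLib

/-!
# Hardy's inequality on the Gaussian graph space `V = H¹(γ)` and the skew drift form
# (tools for the rotating conjugate density, stub B2 of line `killing-twisted-bernoulli-solitons`,
# crux `Target`, stmt-NavierStokesRegularity-1217)

Helper file (all results proved, no definitions, no named facts). The tree realises the positive
weight of Pineau–Vicol 2026, Prop. 5.1 (B. Pineau, V. Vicol, arXiv:2607.09619), for a BOUNDED
divergence-free drift `U` (`Literature.Analysis.FluidPDE.PineauVicol2026.DriftHyp.exists_weight`)
by Lax–Milgram on the Gaussian graph space `V = gaussGraph` (`PineauVicolGaussSobolev`,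
`PineauVicolWeightExistence`). In the rotating gauge of a rotated self-similar profile the drift
acquires the unbounded, tangential, divergence-free term `−α J y` (`J = rotGen`), and the weak
form of `L*_α(γ v) = 0` acquires the first-order term `∫ γ ⟪J y, ∇v⟫ φ`, which is NOT bounded on
`L²(γ) × L²(γ; E)` — one factor carries the weight `|y|`. This file supplies the missing
functional analysis, for a finite-dimensional real inner product space `E` and any continuous
linear `J : E →L[ℝ] E`:

* `lintegral_hardy_of_mem_gaussGraph`, `integral_hardy_of_mem_gaussGraph`: the weighted Hardy
  inequality `∫ γ |y|² f² ≤ (4d+16) ‖x‖²_V` for EVERY `x = (f, G) ∈ V` (the tree has it for test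
  functions, `integral_norm_sq_mul_sq_mul_gaussWeight_le_norm_sq`; passage to the closure by
  a.e.-convergent subsequences and Fatou);
* `memLp_fst_smul_of_mem_gaussGraph`: hence `y ↦ f(y) J y ∈ L²(γ; E)` with
  `∫ γ ‖f J y‖² ≤ ‖J‖² (4d+16) ‖x‖²`;
* `exists_momentMap`: the bounded "moment map" `M : V →L L²(γ; E)`, `M (f, G) = f · J y` a.e.;
* `exists_skewForm`: for SKEW `J` (`⟪J v, v⟫ = 0`), the continuous bilinear form
  `R (f,G) (f',G') = ∫ γ ⟪G, f' J y⟫` on `V`, and its two structural identities: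
  `R x x = 0` (the rotation drift is `L²(γ)`-skew: `∫ γ φ ⟪∇φ, Jy⟫ = ½∫ γ ⟪∇φ², Jy⟫ = 0` because
  `div J = tr J = 0` and `⟪J y, y⟫ = 0`, then density) and `R x (1, 0) = 0` (polarisation).

These are exactly the inputs that let the tree's coercivity / Lax–Milgram / Fredholm argument run
unchanged for the twisted form `a + R` (next file,
`TypeICertificateLadderTargetRotatingConjugateDensityWeak`).

References: B. Pineau, V. Vicol, arXiv:2607.09619 (2026), Prop. 5.1, Remark 5.2;
L. C. Evans, *Partial Differential Equations* (2010), §6.2.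
-/

noncomputable section

open MeasureTheory TopologicalSpace Set Function Filter Topology InnerProductSpace Real
open scoped RealInnerProductSpace ENNReal NNReal ContDiff Distributions

namespace Summit.NavierStokesRegularity.NavierStokesRegularity.Theorems

open Literature.Analysis.FluidPDE Literature.Analysis.FluidPDE.PineauVicol2026

variable {E : Type*} [NormedAddCommGroup E] [InnerProductSpace ℝ E] [FiniteDimensional ℝ E]
  [MeasurableSpace E] [BorelSpace E]

/-! ### Hardy's inequality on the closure `V` -/

/-- `γ |y|² φ²` is integrable for a test function `φ`. [folklore] -/
theorem integrable_gaussWeight_mul_norm_sq_mul_sq (φ : 𝓓((⊤ : Opens E), ℝ)) :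
    Integrable (fun y => gaussWeight y * (‖y‖ ^ 2 * (φ : E → ℝ) y ^ 2)) :=
  (continuous_gaussWeight.mul ((continuous_norm.pow 2).mul (φ.continuous.pow 2))).integrable_of_hasCompactSupport
    ((hasCompactSupport_sq φ).mul_left).mul_left

/-- Hardy's inequality for graph pairs, `lintegral` form:
`∫⁻ γ |y|² φ² ≤ (4d+16) ‖(φ, ∇φ)‖²`. [folklore] -/
theorem lintegral_hardy_testPair (φ : 𝓓((⊤ : Opens E), ℝ)) :
    ∫⁻ y, ENNReal.ofReal (gaussWeight y * (‖y‖ ^ 2 * (φ : E → ℝ) y ^ 2)) ≤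
      ENNReal.ofReal ((4 * Module.finrank ℝ E + 16) * ‖testPair φ‖ ^ 2) := by
  rw [← ofReal_integral_eq_lintegral_ofReal (integrable_gaussWeight_mul_norm_sq_mul_sq φ)
    (Eventually.of_forall fun y => mul_nonneg (gaussWeight_pos y).le (by positivity))]
  refine ENNReal.ofReal_le_ofReal ?_
  calc ∫ y, gaussWeight y * (‖y‖ ^ 2 * (φ : E → ℝ) y ^ 2)
      = ∫ y, ‖y‖ ^ 2 * (φ : E → ℝ) y ^ 2 * gaussWeight y :=
        integral_congr_ae (Eventually.of_forall fun y => by ring)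
    _ ≤ _ := integral_norm_sq_mul_sq_mul_gaussWeight_le_norm_sq φ

/-- **Hardy's inequality on `V`** (`lintegral` form): for `x = (f, G) ∈ V`,
`∫⁻ γ |y|² f² ≤ (4d+16) ‖x‖²` — along a sequence of graph pairs converging to `x`, a subsequence of
first components converges a.e., and Fatou's lemma passes the test-function inequality to the
limit. [folklore] -/
theorem lintegral_hardy_of_mem_gaussGraph {x : GaussProd E} (hx : x ∈ gaussGraph (E := E)) :
    ∫⁻ y, ENNReal.ofReal (gaussWeight y * (‖y‖ ^ 2 * (x.fst : E → ℝ) y ^ 2)) ≤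
      ENNReal.ofReal ((4 * Module.finrank ℝ E + 16) * ‖x‖ ^ 2) := by
  obtain ⟨φ, hφ⟩ := mem_gaussGraph_iff_seq.1 hx
  set C : ℝ := 4 * Module.finrank ℝ E + 16 with hC
  have h0 : Tendsto (fun n => (testPair (φ n)).fst) atTop (𝓝 x.fst) :=
    ((WithLp.fstL 2 ℝ (GaussL2 E) (GaussL2Vec E)).continuous.tendsto x).comp hφ
  obtain ⟨ns, hns, hae⟩ := (tendstoInMeasure_of_tendsto_Lp h0).exists_seq_tendsto_ae
  have hrep : ∀ᵐ y ∂(volume : Measure E), ∀ k, (((testPair (φ (ns k))).fst : GaussL2 E) : E → ℝ) y =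
      (φ (ns k) : E → ℝ) y := by
    rw [ae_all_iff]
    exact fun k => ae_gaussMeasure_iff.1 (coeFn_testPair_fst _)
  have hae' : ∀ᵐ y ∂(volume : Measure E),
      Tendsto (fun k => (φ (ns k) : E → ℝ) y) atTop (𝓝 ((x.fst : E → ℝ) y)) := by
    filter_upwards [ae_gaussMeasure_iff.1 hae, hrep] with y hy hr
    exact hy.congr fun k => hr k
  set G : ℕ → E → ℝ≥0∞ := fun k y =>
    ENNReal.ofReal (gaussWeight y * (‖y‖ ^ 2 * (φ (ns k) : E → ℝ) y ^ 2)) with hG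
  have hGm : ∀ k, AEMeasurable (G k) volume := fun k =>
    (continuous_gaussWeight.mul ((continuous_norm.pow 2).mul ((φ (ns k)).continuous.pow 2))).measurable
      |>.ennreal_ofReal.aemeasurable
  have hlim : ∀ᵐ y ∂(volume : Measure E), Tendsto (fun k => G k y) atTop
      (𝓝 (ENNReal.ofReal (gaussWeight y * (‖y‖ ^ 2 * (x.fst : E → ℝ) y ^ 2)))) := by
    filter_upwards [hae'] with y hy
    exact ENNReal.tendsto_ofReal (((hy.pow 2).const_mul _).const_mul _)
  have hF : ∫⁻ y, ENNReal.ofReal (gaussWeight y * (‖y‖ ^ 2 * (x.fst : E → ℝ) y ^ 2)) ≤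
      liminf (fun k => ∫⁻ y, G k y) atTop :=
    calc ∫⁻ y, ENNReal.ofReal (gaussWeight y * (‖y‖ ^ 2 * (x.fst : E → ℝ) y ^ 2))
        = ∫⁻ y, liminf (fun k => G k y) atTop :=
          lintegral_congr_ae (by filter_upwards [hlim] with y hy; exact hy.liminf_eq.symm)
      _ ≤ liminf (fun k => ∫⁻ y, G k y) atTop := lintegral_liminf_le' hGm
  have hGk : ∀ k, ∫⁻ y, G k y ≤ ENNReal.ofReal (C * ‖testPair (φ (ns k))‖ ^ 2) := fun k =>
    lintegral_hardy_testPair (φ (ns k))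
  have hR : Tendsto (fun k => ENNReal.ofReal (C * ‖testPair (φ (ns k))‖ ^ 2)) atTop
      (𝓝 (ENNReal.ofReal (C * ‖x‖ ^ 2))) :=
    ENNReal.tendsto_ofReal ((((continuous_norm.tendsto x).comp (hφ.comp hns.tendsto_atTop)).pow 2).const_mul C)
  calc ∫⁻ y, ENNReal.ofReal (gaussWeight y * (‖y‖ ^ 2 * (x.fst : E → ℝ) y ^ 2))
      ≤ liminf (fun k => ∫⁻ y, G k y) atTop := hF
    _ ≤ liminf (fun k => ENNReal.ofReal (C * ‖testPair (φ (ns k))‖ ^ 2)) atTop :=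
        liminf_le_liminf (Eventually.of_forall hGk)
    _ = ENNReal.ofReal (C * ‖x‖ ^ 2) := hR.liminf_eq

/-- The Hardy integrand `γ |y|² f²` of an element of `V` is a.e. strongly measurable. [folklore] -/
theorem aestronglyMeasurable_hardy (x : GaussProd E) :
    AEStronglyMeasurable (fun y => gaussWeight y * (‖y‖ ^ 2 * (x.fst : E → ℝ) y ^ 2)) (volume : Measure E) := by
  have hf : AEStronglyMeasurable (x.fst : E → ℝ) (volume : Measure E) :=
    (Lp.aestronglyMeasurable (x.fst : GaussL2 E)).mono_ac absolutelyContinuous_gaussMeasure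
  exact continuous_gaussWeight.aestronglyMeasurable.mul ((continuous_norm.pow 2).aestronglyMeasurable.mul (hf.pow 2))

/-- **Hardy's inequality on `V`, integrability**: `γ |y|² f²` is integrable for `(f, G) ∈ V`. [folklore] -/
theorem integrable_hardy_of_mem_gaussGraph {x : GaussProd E} (hx : x ∈ gaussGraph (E := E)) :
    Integrable (fun y => gaussWeight y * (‖y‖ ^ 2 * (x.fst : E → ℝ) y ^ 2)) := by
  refine ⟨aestronglyMeasurable_hardy x, ?_⟩
  rw [hasFiniteIntegral_iff_ofReal (Eventually.of_forall fun y => mul_nonneg (gaussWeight_pos y).le (by positivity))]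
  exact (lintegral_hardy_of_mem_gaussGraph hx).trans_lt ENNReal.ofReal_lt_top

/-- **Hardy's inequality on `V`**: `∫ γ |y|² f² ≤ (4d+16) ‖x‖²` for `x = (f, G) ∈ V`. [folklore] -/
theorem integral_hardy_of_mem_gaussGraph {x : GaussProd E} (hx : x ∈ gaussGraph (E := E)) :
    ∫ y, gaussWeight y * (‖y‖ ^ 2 * (x.fst : E → ℝ) y ^ 2) ≤ (4 * Module.finrank ℝ E + 16) * ‖x‖ ^ 2 := by
  have h := lintegral_hardy_of_mem_gaussGraph hx
  rw [← ofReal_integral_eq_lintegral_ofReal (integrable_hardy_of_mem_gaussGraph hx)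
    (Eventually.of_forall fun y => mul_nonneg (gaussWeight_pos y).le (by positivity))] at h
  exact (ENNReal.ofReal_le_ofReal_iff (by positivity)).1 h

/-! ### The moment map `(f, G) ↦ f · J y` -/

/-- For `x = (f, G) ∈ V` and a continuous linear `J`, `y ↦ f(y) J y` lies in `L²(γ; E)`. [folklore] -/
theorem memLp_fst_smul_of_mem_gaussGraph {x : GaussProd E} (hx : x ∈ gaussGraph (E := E)) (J : E →L[ℝ] E) :
    MemLp (fun y => (x.fst : E → ℝ) y • J y) 2 (gaussMeasure (E := E)) := by
  have hf : AEStronglyMeasurable (x.fst : E → ℝ) (volume : Measure E) :=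
    (Lp.aestronglyMeasurable (x.fst : GaussL2 E)).mono_ac absolutelyContinuous_gaussMeasure
  have hm : AEStronglyMeasurable (fun y => (x.fst : E → ℝ) y • J y) (gaussMeasure (E := E)) :=
    (hf.smul J.continuous.aestronglyMeasurable).mono_ac gaussMeasure_absolutelyContinuous
  rw [memLp_two_iff_integrable_sq_norm hm, integrable_gaussMeasure_iff]
  refine ((integrable_hardy_of_mem_gaussGraph hx).const_mul (‖J‖ ^ 2)).mono'
    (continuous_gaussWeight.aestronglyMeasurable.smul ((hf.smul J.continuous.aestronglyMeasurable).norm.pow 2))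
    (Eventually.of_forall fun y => ?_)
  rw [norm_smul, Real.norm_of_nonneg (gaussWeight_pos y).le, Real.norm_of_nonneg (sq_nonneg _), norm_smul,
    Real.norm_eq_abs]
  have hJ : ‖J y‖ ≤ ‖J‖ * ‖y‖ := J.le_opNorm y
  have hγ := (gaussWeight_pos y).le
  have h1 : (|(x.fst : E → ℝ) y| * ‖J y‖) ^ 2 ≤ ‖J‖ ^ 2 * (‖y‖ ^ 2 * (x.fst : E → ℝ) y ^ 2) := by
    have h2 : |(x.fst : E → ℝ) y| * ‖J y‖ ≤ |(x.fst : E → ℝ) y| * (‖J‖ * ‖y‖) :=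
      mul_le_mul_of_nonneg_left hJ (abs_nonneg _)
    calc (|(x.fst : E → ℝ) y| * ‖J y‖) ^ 2 ≤ (|(x.fst : E → ℝ) y| * (‖J‖ * ‖y‖)) ^ 2 :=
          pow_le_pow_left₀ (by positivity) h2 2
      _ = ‖J‖ ^ 2 * (‖y‖ ^ 2 * (x.fst : E → ℝ) y ^ 2) := by rw [mul_pow, mul_pow, sq_abs]; ring
  calc gaussWeight y * (|(x.fst : E → ℝ) y| * ‖J y‖) ^ 2
      ≤ gaussWeight y * (‖J‖ ^ 2 * (‖y‖ ^ 2 * (x.fst : E → ℝ) y ^ 2)) := mul_le_mul_of_nonneg_left h1 hγ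
    _ = ‖J‖ ^ 2 * (gaussWeight y * (‖y‖ ^ 2 * (x.fst : E → ℝ) y ^ 2)) := by ring

/-- The `L²(γ; E)` norm of `f · J y`: `‖f J‖² ≤ ‖J‖² (4d+16) ‖x‖²`. [folklore] -/
theorem norm_sq_toLp_fst_smul_le {x : GaussProd E} (hx : x ∈ gaussGraph (E := E)) (J : E →L[ℝ] E) :
    ‖(memLp_fst_smul_of_mem_gaussGraph hx J).toLp _‖ ^ 2 ≤
      ‖J‖ ^ 2 * ((4 * Module.finrank ℝ E + 16) * ‖x‖ ^ 2) := by
  rw [norm_sq_gaussL2Vec]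
  have e1 : ∫ y, gaussWeight y * ‖(((memLp_fst_smul_of_mem_gaussGraph hx J).toLp _ : GaussL2Vec E) : E → E) y‖ ^ 2 =
      ∫ y, gaussWeight y * ‖(x.fst : E → ℝ) y • J y‖ ^ 2 := by
    refine integral_congr_ae ?_
    filter_upwards [ae_gaussMeasure_iff.1 (memLp_fst_smul_of_mem_gaussGraph hx J).coeFn_toLp] with y hy
    rw [hy]
  rw [e1]
  calc ∫ y, gaussWeight y * ‖(x.fst : E → ℝ) y • J y‖ ^ 2
      ≤ ∫ y, ‖J‖ ^ 2 * (gaussWeight y * (‖y‖ ^ 2 * (x.fst : E → ℝ) y ^ 2)) := by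
        refine integral_mono_of_nonneg (Eventually.of_forall fun y => mul_nonneg (gaussWeight_pos y).le (by positivity))
          ((integrable_hardy_of_mem_gaussGraph hx).const_mul _) (Eventually.of_forall fun y => ?_)
        have hγ := (gaussWeight_pos y).le
        have hJ : ‖J y‖ ≤ ‖J‖ * ‖y‖ := J.le_opNorm y
        dsimp only
        rw [norm_smul, Real.norm_eq_abs]
        have h2 : |(x.fst : E → ℝ) y| * ‖J y‖ ≤ |(x.fst : E → ℝ) y| * (‖J‖ * ‖y‖) :=
          mul_le_mul_of_nonneg_left hJ (abs_nonneg _)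
        have h1 : (|(x.fst : E → ℝ) y| * ‖J y‖) ^ 2 ≤ ‖J‖ ^ 2 * (‖y‖ ^ 2 * (x.fst : E → ℝ) y ^ 2) := by
          calc (|(x.fst : E → ℝ) y| * ‖J y‖) ^ 2 ≤ (|(x.fst : E → ℝ) y| * (‖J‖ * ‖y‖)) ^ 2 :=
                pow_le_pow_left₀ (by positivity) h2 2
            _ = ‖J‖ ^ 2 * (‖y‖ ^ 2 * (x.fst : E → ℝ) y ^ 2) := by rw [mul_pow, mul_pow, sq_abs]; ring
        calc gaussWeight y * (|(x.fst : E → ℝ) y| * ‖J y‖) ^ 2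
            ≤ gaussWeight y * (‖J‖ ^ 2 * (‖y‖ ^ 2 * (x.fst : E → ℝ) y ^ 2)) := mul_le_mul_of_nonneg_left h1 hγ
          _ = ‖J‖ ^ 2 * (gaussWeight y * (‖y‖ ^ 2 * (x.fst : E → ℝ) y ^ 2)) := by ring
    _ = ‖J‖ ^ 2 * ∫ y, gaussWeight y * (‖y‖ ^ 2 * (x.fst : E → ℝ) y ^ 2) := integral_const_mul _ _
    _ ≤ ‖J‖ ^ 2 * ((4 * Module.finrank ℝ E + 16) * ‖x‖ ^ 2) :=
        mul_le_mul_of_nonneg_left (integral_hardy_of_mem_gaussGraph hx) (sq_nonneg _)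

/-- **The moment map.** For a continuous linear `J : E → E` there is a bounded linear map
`M : V → L²(γ; E)` with `M (f, G) = f · J y` almost everywhere (bounded by Hardy's inequality on
`V`). [folklore] -/
theorem exists_momentMap (J : E →L[ℝ] E) :
    ∃ M : gaussGraph (E := E) →L[ℝ] GaussL2Vec E, ∀ v : gaussGraph (E := E),
      ((M v : GaussL2Vec E) : E → E) =ᵐ[gaussMeasure] fun y => (((v : GaussProd E).fst : GaussL2 E) : E → ℝ) y • J y := by
  set C : ℝ := 4 * Module.finrank ℝ E + 16 with hC
  have hC0 : 0 ≤ C := by positivity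
  let M₀ : gaussGraph (E := E) →ₗ[ℝ] GaussL2Vec E :=
    { toFun := fun v => (memLp_fst_smul_of_mem_gaussGraph v.2 J).toLp _
      map_add' := fun v w => by
        rw [← MemLp.toLp_add (memLp_fst_smul_of_mem_gaussGraph v.2 J) (memLp_fst_smul_of_mem_gaussGraph w.2 J)]
        refine MemLp.toLp_congr _ _ ?_
        have h : (((v + w : gaussGraph (E := E)) : GaussProd E).fst : GaussL2 E) =
            ((v : GaussProd E).fst : GaussL2 E) + ((w : GaussProd E).fst : GaussL2 E) := rfl
        rw [h]
        filter_upwards [Lp.coeFn_add (((v : GaussProd E).fst : GaussL2 E)) (((w : GaussProd E).fst : GaussL2 E))]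
          with y hy
        simp only [hy, Pi.add_apply, add_smul]
      map_smul' := fun c v => by
        rw [RingHom.id_apply, ← MemLp.toLp_const_smul c (memLp_fst_smul_of_mem_gaussGraph v.2 J)]
        refine MemLp.toLp_congr _ _ ?_
        have h : (((c • v : gaussGraph (E := E)) : GaussProd E).fst : GaussL2 E) =
            c • ((v : GaussProd E).fst : GaussL2 E) := rfl
        rw [h]
        filter_upwards [Lp.coeFn_smul c (((v : GaussProd E).fst : GaussL2 E))] with y hy
        simp only [hy, Pi.smul_apply, smul_eq_mul, mul_smul] }
  have hbound : ∀ v : gaussGraph (E := E), ‖M₀ v‖ ≤ ‖J‖ * Real.sqrt C * ‖v‖ := by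
    intro v
    have h1 : ‖M₀ v‖ ^ 2 ≤ (‖J‖ * Real.sqrt C * ‖v‖) ^ 2 := by
      calc ‖M₀ v‖ ^ 2 ≤ ‖J‖ ^ 2 * (C * ‖(v : GaussProd E)‖ ^ 2) := norm_sq_toLp_fst_smul_le v.2 J
        _ = (‖J‖ * Real.sqrt C * ‖v‖) ^ 2 := by
          rw [mul_pow, mul_pow, Real.sq_sqrt hC0, Submodule.coe_norm]; ring
    exact (pow_le_pow_iff_left₀ (norm_nonneg _) (by positivity) two_ne_zero).1 h1
  refine ⟨M₀.mkContinuous (‖J‖ * Real.sqrt C) hbound, fun v => ?_⟩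
  exact (memLp_fst_smul_of_mem_gaussGraph v.2 J).coeFn_toLp

/-! ### The skew drift form `R (f,G) (f',G') = ∫ γ ⟪G, f' J y⟫` -/

omit [MeasurableSpace E] [BorelSpace E] in
/-- The divergence of a skew linear field vanishes: `div J = tr J = Σᵢ ⟪bᵢ, J bᵢ⟫ = 0`. [folklore] -/
theorem divergence_eq_zero_of_skew {J : E →L[ℝ] E} (hJ : ∀ v, ⟪J v, v⟫ = 0) (y : E) :
    VectorCalculus.divergence (J : E → E) y = 0 := by
  rw [divergence_eq_sum_inner_fderiv (stdOrthonormalBasis ℝ E)]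
  refine Finset.sum_eq_zero fun i _ => ?_
  rw [ContinuousLinearMap.fderiv, real_inner_comm, hJ]

/-- **The rotation drift is `L²(γ)`-skew on test functions**: `∫ γ ⟪∇φ, φ J y⟫ = ½ ∫ γ ⟪∇φ², J y⟫
= −½ ∫ γ φ² (div J − ½⟪J y, y⟫) = 0` for skew `J`. [folklore] -/
theorem integral_gaussWeight_inner_gradient_smul_eq_zero {J : E →L[ℝ] E} (hJ : ∀ v, ⟪J v, v⟫ = 0)
    (φ : 𝓓((⊤ : Opens E), ℝ)) :
    ∫ y, gaussWeight y * ⟪gradient (φ : E → ℝ) y, (φ : E → ℝ) y • J y⟫ = 0 := by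
  have hφ1 : ContDiff ℝ 1 (φ : E → ℝ) := φ.contDiff.of_le (mod_cast le_top)
  have hθ : ContDiff ℝ 1 (fun z => (φ : E → ℝ) z ^ 2) := hφ1.pow 2
  have h := integral_gaussWeight_inner_gradient_eq hθ (hasCompactSupport_sq φ) (J.contDiff (n := 1))
  have h0 : ∫ y, gaussWeight y * ((φ : E → ℝ) y ^ 2 *
      (VectorCalculus.divergence (J : E → E) y - ⟪J y, y⟫ / 2)) = 0 := by
    refine integral_eq_zero_of_ae (Eventually.of_forall fun y => ?_)
    simp [divergence_eq_zero_of_skew hJ, hJ y]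
  rw [h0, neg_zero] at h
  have e : ∀ y, gaussWeight y * ⟪gradient (φ : E → ℝ) y, (φ : E → ℝ) y • J y⟫ =
      (1 / 2 : ℝ) * (gaussWeight y * ⟪gradient (fun z => (φ : E → ℝ) z ^ 2) y, J y⟫) := by
    intro y
    rw [gradient_sq (φ.contDiff.differentiable (by simp)) y, real_inner_smul_left, real_inner_smul_right]
    ring
  calc ∫ y, gaussWeight y * ⟪gradient (φ : E → ℝ) y, (φ : E → ℝ) y • J y⟫
      = ∫ y, (1 / 2 : ℝ) * (gaussWeight y * ⟪gradient (fun z => (φ : E → ℝ) z ^ 2) y, J y⟫) :=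
        integral_congr_ae (Eventually.of_forall e)
    _ = 0 := by rw [integral_const_mul, h, mul_zero]

/-- **The skew drift form on `V`.** For a skew continuous linear `J` (`⟪J v, v⟫ = 0`) there is a
continuous bilinear form `R` on `V = H¹(γ)` with
`R (f, G) (f', G') = ∫ γ ⟪G, f' J y⟫` (the weak form of the first-order term `(J y · ∇v) v'` of
the rotating-gauge operator, bounded by Hardy's inequality on `V`), which is **alternating**,
`R x x = 0` (density of graph pairs and `integral_gaussWeight_inner_gradient_smul_eq_zero`), and
**kills the constant pair**, `R x (1, 0) = 0` (polarisation, as `(1, 0)` has zero gradient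
component). [folklore] -/
theorem exists_skewForm {J : E →L[ℝ] E} (hJ : ∀ v, ⟪J v, v⟫ = 0) :
    ∃ R : gaussGraph (E := E) →L[ℝ] gaussGraph (E := E) →L[ℝ] ℝ,
      (∀ v v' : gaussGraph (E := E), R v v' =
        ∫ y, gaussWeight y * ⟪(((v : GaussProd E).snd : GaussL2Vec E) : E → E) y,
          ((((v' : GaussProd E).fst : GaussL2 E) : E → ℝ) y) • J y⟫) ∧
      (∀ v : gaussGraph (E := E), R v v = 0) ∧
      (∀ v : gaussGraph (E := E), R v ⟨gaussOnePair, gaussOnePair_mem_gaussGraph⟩ = 0) := by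
  obtain ⟨M, hM⟩ := exists_momentMap (E := E) J
  set S : gaussGraph (E := E) →L[ℝ] GaussL2Vec E :=
    (WithLp.sndL 2 ℝ (GaussL2 E) (GaussL2Vec E)).comp (gaussGraph (E := E)).subtypeL with hS
  set R : gaussGraph (E := E) →L[ℝ] gaussGraph (E := E) →L[ℝ] ℝ :=
    (((innerSL ℝ : GaussL2Vec E →L[ℝ] GaussL2Vec E →L[ℝ] ℝ).comp S).flip.comp M).flip
  have hRapply : ∀ v v' : gaussGraph (E := E), R v v' = ⟪((v : GaussProd E).snd : GaussL2Vec E), M v'⟫ :=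
    fun v v' => rfl
  have hRint : ∀ v v' : gaussGraph (E := E), R v v' =
      ∫ y, gaussWeight y * ⟪(((v : GaussProd E).snd : GaussL2Vec E) : E → E) y,
        ((((v' : GaussProd E).fst : GaussL2 E) : E → ℝ) y) • J y⟫ := by
    intro v v'
    rw [hRapply, inner_gaussL2Vec]
    refine integral_congr_ae ?_
    filter_upwards [ae_gaussMeasure_iff.1 (hM v')] with y hy
    rw [hy]
  -- the diagonal vanishes on graph pairs
  have hdiag0 : ∀ φ : 𝓓((⊤ : Opens E), ℝ),
      R ⟨testPair φ, testPair_mem_gaussGraph φ⟩ ⟨testPair φ, testPair_mem_gaussGraph φ⟩ = 0 := by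
    intro φ
    rw [hRint]
    have e : ∫ y, gaussWeight y * ⟪(((testPair φ).snd : GaussL2Vec E) : E → E) y,
        ((((testPair φ).fst : GaussL2 E) : E → ℝ) y) • J y⟫ =
        ∫ y, gaussWeight y * ⟪gradient (φ : E → ℝ) y, (φ : E → ℝ) y • J y⟫ := by
      refine integral_congr_ae ?_
      filter_upwards [ae_gaussMeasure_iff.1 (coeFn_testPair_fst φ),
        ae_gaussMeasure_iff.1 (coeFn_testPair_snd φ)] with y h1 h2
      rw [h1, h2]
    exact e.trans (integral_gaussWeight_inner_gradient_smul_eq_zero hJ φ)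
  -- hence on all of `V`, by density and continuity of the quadratic form
  have hdiag : ∀ v : gaussGraph (E := E), R v v = 0 := by
    intro v
    obtain ⟨φ, hφ⟩ := mem_gaussGraph_iff_seq.1 v.2
    have ht : Tendsto (fun n => (⟨testPair (φ n), testPair_mem_gaussGraph (φ n)⟩ : gaussGraph (E := E)))
        atTop (𝓝 v) := by
      rw [tendsto_subtype_rng]
      exact hφ
    have hc : Continuous fun w : gaussGraph (E := E) => R w w :=
      R.continuous₂.comp (continuous_id.prodMk continuous_id)
    have hlim := (hc.tendsto v).comp ht
    have hzero : ((fun w : gaussGraph (E := E) => R w w) ∘ fun n =>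
        (⟨testPair (φ n), testPair_mem_gaussGraph (φ n)⟩ : gaussGraph (E := E))) = fun _ => (0 : ℝ) :=
      funext fun n => hdiag0 (φ n)
    rw [hzero] at hlim
    exact (tendsto_nhds_unique tendsto_const_nhds hlim).symm
  refine ⟨R, hRint, hdiag, fun v => ?_⟩
  -- polarisation: `0 = R (v+1) (v+1) = R v v + R v 1 + R 1 v + R 1 1` and `R 1 · = ⟪0, ·⟫ = 0`
  set one : gaussGraph (E := E) := ⟨gaussOnePair, gaussOnePair_mem_gaussGraph⟩ with hone
  have h2 : ∀ w : gaussGraph (E := E), R one w = 0 := fun w => by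
    rw [hRapply]
    change ⟪((gaussOnePair (E := E)).snd : GaussL2Vec E), M w⟫ = 0
    rw [gaussOnePair_snd, inner_zero_left]
  have h1 := hdiag (v + one)
  rw [map_add, map_add, _root_.add_apply, _root_.add_apply, hdiag v, h2 v, h2 one] at h1
  linarith

/-- **Registered form (B2 tool stub `rotatingDensity_skewForm`, physical space `ℝ³`).** For a
skew continuous linear `J` on `ℝ³` (e.g. `α • rotGenL`): the alternating continuous bilinear
form `R (f,G) (f',G') = ∫ γ ⟪G, f' J y⟫` on `V = H¹(γ)` with `R x x = 0` and `R x (1,0) = 0`. [folklore] -/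
theorem rotatingDensity_skewForm :
    ∀ (J : EuclideanSpace ℝ (Fin 3) →L[ℝ] EuclideanSpace ℝ (Fin 3)), (∀ v : EuclideanSpace ℝ (Fin 3), inner ℝ (J v) v = 0) → ∃ R : Literature.Analysis.FluidPDE.PineauVicol2026.gaussGraph (E := EuclideanSpace ℝ (Fin 3)) →L[ℝ] Literature.Analysis.FluidPDE.PineauVicol2026.gaussGraph (E := EuclideanSpace ℝ (Fin 3)) →L[ℝ] ℝ, (∀ v v' : Literature.Analysis.FluidPDE.PineauVicol2026.gaussGraph (E := EuclideanSpace ℝ (Fin 3)), R v v' = ∫ y : EuclideanSpace ℝ (Fin 3), Literature.Analysis.FluidPDE.PineauVicol2026.gaussWeight y * inner ℝ ((((v : Literature.Analysis.FluidPDE.PineauVicol2026.GaussProd (EuclideanSpace ℝ (Fin 3))).snd : Literature.Analysis.FluidPDE.PineauVicol2026.GaussL2Vec (EuclideanSpace ℝ (Fin 3))) : EuclideanSpace ℝ (Fin 3) → EuclideanSpace ℝ (Fin 3)) y) (((((v' : Literature.Analysis.FluidPDE.PineauVicol2026.GaussProd (EuclideanSpace ℝ (Fin 3))).fst : Literature.Analysis.FluidPDE.PineauVicol2026.GaussL2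 (EuclideanSpace ℝ (Fin 3))) : EuclideanSpace ℝ (Fin 3) → ℝ) y) • J y)) ∧ (∀ v : Literature.Analysis.FluidPDE.PineauVicol2026.gaussGraph (E := EuclideanSpace ℝ (Fin 3)), R v v = 0) ∧ (∀ v : Literature.Analysis.FluidPDE.PineauVicol2026.gaussGraph (E := EuclideanSpace ℝ (Fin 3)), R v ⟨Literature.Analysis.FluidPDE.PineauVicol2026.gaussOnePair, Literature.Analysis.FluidPDE.PineauVicol2026.gaussOnePair_mem_gaussGraph⟩ = 0) :=
  fun _ hJ => exists_skewForm hJ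

end Summit.NavierStokesRegularity.NavierStokesRegularity.Theorems
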